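import Mathlib
import HarnessLib

/-!
# Magnen–Rivasseau–Sénéor, *Construction of YM₄ with an infrared cutoff* (CMP 155, 1993), §II.B — LEMMA II.1 (the small
# factor per large-field box) AS PRINTED, with the printed ingredients of its sketch of proof: the interpolations (II.25)/(II.29a),
# the two-step bound behind (II.27), and the local-factorial arithmetic (II.28)

statement-level skeleton of published theorems with citation tags; proofs where landed; nothing here is a claim about the
Yang–Mills mass gap, about continuum YM₄ on T⁴, or about the Clay problem

**Citation header (reproduction of PUBLISHED work).** J. Magnen, V. Rivasseau, R. Sénéor, *Construction of YM₄ with an infrared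
cutoff*, Commun. Math. Phys. **155** (1993) 325–383 [MagnenRivasseauSeneor1993], Sect. II.B «The Small Field and Large Field
Decomposition», pp. 334–338. Loci «p.NNN [PDF nn] tl.k» = journal page, PDF page (= journal page − 324) and text-layer line of the
held Project-Euclid scan `paper:magnen1993-cmp155-mrs-ym4-infrared-cutoff` (PDF sha256 fa4ddac3…); every DISPLAY quoted below was
read on the page images `run/shared/lean/pub/lit-balaban/inprint/lit-balaban-p14/renders-cmp155/` (`p11_full_s6.png`,
`p11_lemmaII1_s2.png`, `p12_full_s6.png`, `p13_full_s6.png`), because the text layer garbles formulas. Cell pub-balaban-gaps (YM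
blitz, track G3), seat mrs-lit-2; companion record `run/shared/lean/pub/pub-balaban-gaps/g3/MRS-AS-PRINTED-estimates.md`. The
paper's MAIN STATEMENT (p.327) and its statement-layer definitions ((II.1)–(II.14), (II.77)/(II.78), (VIII.6)) are seat mrs-lit-1's
files in this directory; the one-loop arithmetic of Lemma III.1 is `MRS93OneLoopCounterterms.lean`. Nothing of theirs is re-typed.

**Grade of record (not this file's to change).** The lit-balaban YM LIT SWEEP (`run/shared/lean/pub/lit-balaban/YM-INPRINT.md`
row D1; two readers, cross-read, fit-ref) grades Lemma II.1 **SKETCH**: its run-in head is «Sketch of proof.» (p.335 tl.32); p.336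
tl.25–26 «However the complete proof of Lemma II.1 is of course more complicated than this sketch»; tl.34–37 «The stability estimates
of Sect. VI then prove that the total weight … is bounded by 1. This really achieves the proof of Lemma II.1»; p.354 tl.35 «the
sketchy Lemma II.1». This file types the STATEMENT and kernel-checks the finite arithmetic the sketch prints; it upgrades nothing.

**What the paper prints (verbatim; displays from the page images).**
* (II.25)–(II.26) p.335 [PDF 11] tl.20–24: «In each box Δ ∈ 𝐃 we write the expansion: 1 = e^{−E_Δ} + ∫₀¹ ds E_Δ e^{−(1−s)E_Δ},
  (II.25) where: E_Δ = (1/Δ) ∫_Δ ((λ_i^t)^{1/2+ε₁} M^{−i} κ̃^{i,α} ∗ A)^{P_i}, (II.26) where P_i = (λ_i^t)^{−ε₁/2}.» tl.25–26: «The set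
  of boxes in which the error term is chosen in (II.25) is called the kernel of the large field region (KLFR).»
* **Lemma II.1** p.335 tl.30–31 (image `p11_lemmaII1_s2.png`, native resolution): «To each box of KLFR ∩ 𝐃^{i,α} we can associate a
  small factor in the functional integral which is e^{−(λ_i^t)^{−ε}}, for some ε = 0.» [sic: the 600 dpi image prints «ε = 0»; a
  «small factor» and (II.28) (exponent −(λ_i^t)^{−ε₁/2}) force the reading «ε > 0» — recorded here, typed as `0 < ε`, not silently.]
* (II.27) p.335 tl.34–38 + p.336 [PDF 12] tl.2–5: «If we slice the propagator C_axial(p) according to the partition of unity given by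
  the functions κ^j(p), we obtain pieces C^j_axial(p) ≡ κ^j(p)C_axial(p) which satisfy, for any fixed large integer q,
  C^j_axial(x − y) ≤ (K_q M^{2i}/λ) (1/(1 + |x₀ − y₀|M^α) · 1/(1 + |x⃗ − y⃗|M^i))^q, (II.27) where K_q is some constant depending
  on q. This bound is immediate if we use integration by parts and the bound
  M^{3i}M^α/(M^{2α} + λ²M^{2i}) ≤ M^{3i}M^α M^{−2rα} λ^{−2(1−r)} M^{−2i(1−r)} ≤ M^{2i}/λ if r = 1/2.»
* (II.28) p.336 tl.18–25: «Each factor E_Δ contains P_i fields which are integrated with respect to C_axial. As is usual when the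
  spatial decrease of the propagator is matched to the shape of the boxes in which the cluster expansion is performed, we obtain a
  product of local factorials in the number of the fields in each box [R]. Therefore for each box Δ we have a factor
  (λ_i^t)^{ε₁P_i} K^{P_i} (P_i/2)! ≤ e^{−(λ_i^t)^{−ε₁/2}} (II.28) if λ_i^t is small enough (such that √K(λ_i^t)^{3ε₁/4} ≤ 1/e,
  recalling that P_i = (λ_i^t)^{−ε₁/2}). This is the small factor announced in Lemma II.1.»
* (II.29a) p.337 [PDF 13] tl.11–15: «In every box of 𝐃 we write: 1 = τ(H_Δ) − ∫₀¹ ds H_Δ τ′((1 − s)H_Δ), (II.29a) where τ is our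
  reference C₀^∞ function» (p.330 tl.33–34: τ is «a one variable C₀^∞ function, monotone decreasing, which is 0 for x > 2 and is 1
  for x < 1»).

**What is typed / proved here (zero `sorry`; zero named facts — every `def … : Prop` below is a PREDICATE on explicit data, to be
taken as a hypothesis by whoever needs it; nothing of MRS's functional analysis is asserted).**
* §1 `interp_exp_identity` — (II.25) as a theorem of calculus, for every real `E`; `interp_tau_identity` — (II.29a) for every `C¹`
  function `τ` with `τ(0) = 1` and every real `H`. (The two interpolation identities that DEFINE the large-field tests.)
* §2 `ineq_p336` — the printed two-step bound behind (II.27), for `M, λ > 0` and every `r ∈ [0,1]` (weighted AM–GM: `x^r y^{1−r} ≤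
  rx + (1−r)y ≤ x + y`), and `ineq_p336_half` — at `r = 1/2` the middle term IS `M^{2i}/λ` (an equality).
* §3 (II.28), THE LOCAL-FACTORIAL ARITHMETIC. `localFactorial_le` — with `P = 2n = λ^{−ε₁/2}` (so that `(P/2)!` is `n!`) and
  `K ≥ 0`: if `K·λ^{3ε₁/4} ≤ 1/e` then `λ^{ε₁P} K^P (P/2)! ≤ e^{−λ^{−ε₁/2}}` (via `n! ≤ nⁿ`, Mathlib `Nat.factorial_le_pow`).
  PRECISION (ours, kernel-checked; immaterial to Lemma II.1): the printed parenthetical carries `√K`, not `K`; read literally together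
  with the factor `K^{P_i}` of (II.28) it is NOT a sufficient condition — `printedCondition_counterexample`: for every `m ≥ 1`,
  `λ = 16^{−m}`, `ε₁ = 1/m`, `P = 4`, `K = (8/e)² = 64/e²` give `√K·λ^{3ε₁/4} = 1/e` exactly, yet
  `λ^{ε₁P} K^P (P/2)! = 512 e^{−8} > e^{−4} = e^{−λ^{−ε₁/2}}` (so neither a smaller `λ` nor a smaller `ε₁` repairs it). With
  `K^{P_i/2}` in place of `K^{P_i}` (one `√K` per field, i.e. `K_q` of (II.27) per propagator) the printed condition IS sufficient:
  `localFactorial_le_sqrt`. Either way «λ_i^t small enough» (depending on `K`, `ε₁`) yields (II.28), which is all Lemma II.1 uses.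
* §4 THE TYPED STATEMENTS. `AxialSliceBound` / `IneqII27Printed` — (II.27) as a predicate on a sliced kernel family
  `C : ℕ → ℕ → ℝ × ℝ³ → ℝ` (indices `i`, `α`; argument `x − y = (x₀ − y₀, x⃗ − y⃗)`), «for any fixed large integer q» rendered
  `∀ q, ∃ K_q` (`axialSliceBound_anti`: the bound for `q` implies the bound for every `q′ ≤ q` with the same constant, so «all large
  q» and «all q» agree); `LargeFieldData` + `LemmaII1Printed` — Lemma II.1 as a predicate: ONE `ε > 0` such that every box of
  `KLFR ∩ 𝐃^{i,α}`, for every `(i, α)`, carries a factor of absolute value `≤ exp(−(λ_i^t)^{−ε})`.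

**Readings (declared).** (i) «we can associate a small factor in the functional integral» is typed as: the expansion supplies, per
box, a real weight `factor i α Δ` whose absolute value obeys the bound; the carrier records nothing about HOW (that is the sketch:
(II.27), (II.28) and Sect. VI). (ii) `lamT : ℕ → ℝ` stands for `λ_i^t` of (II.12) (mrs-lit-1's statement layer); here it is abstract
data. (iii) `P_i = (λ_i^t)^{−ε₁/2}` is taken as printed (an exact equality) together with `P_i` even — it is the exponent of the field
monomial (II.26) and (II.28) writes `(P_i/2)!` (cf. (II.29b) p.337 «P_{1,i} is an even integer close to (λ_i^t)^{−ε₁/32}»). (iv) In §2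
the indices `i`, `α` are naturals and `M > 0` is real (p.335 tl.18 «It is convenient to take M an integer»). (v) (II.27) prints
`C^j_axial(x − y) ≤ …` for a (matrix-valued) kernel; typed, as is customary, as a bound on the absolute value of the scalar entries,
which implies the printed one-sided inequality. (vi) `λ` is a Lean keyword: the coupling is spelled `lam`.

**What is NOT claimed.** The cluster expansion between large-field boxes, the «product of local factorials … [R]», the corridor
combinatorics (p.337 tl.1–4, the «golden rule» `λ^{−ε₁/2} ≫ p`), the positivity bookkeeping of `−F²_sp` versus `λ⟨A, p²A⟩`, and the
Sect. VI input that «really achieves the proof of Lemma II.1» — none is formalised; (II.27) itself (an integration-by-parts estimate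
on the sliced axial propagator) is a typed predicate, not a theorem. Nothing here bears on Bałaban's papers.
-/

noncomputable section

open Real MeasureTheory Set intervalIntegral
open scoped Nat

namespace Literature.MathematicalPhysics.QuantumFieldTheory.MagnenRivasseauSeneor1993

namespace LargeField

/-! ## §1 The interpolation identities (II.25) and (II.29a) -/

/-- **(II.25)** p.335 [PDF 11] tl.20–21: «In each box Δ ∈ 𝐃 we write the expansion: `1 = e^{−E_Δ} + ∫₀¹ ds E_Δ e^{−(1−s)E_Δ}`» —
true for every real number `E_Δ` (fundamental theorem of calculus for `s ↦ e^{−(1−s)E}`).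
[cite: MagnenRivasseauSeneor1993, §II.B (II.25) p.335] -/
theorem interp_exp_identity (E : ℝ) :
    Real.exp (-E) + ∫ s in (0 : ℝ)..1, E * Real.exp (-((1 - s) * E)) = 1 := by
  have hder : ∀ s ∈ uIcc (0 : ℝ) 1,
      HasDerivAt (fun s : ℝ => Real.exp (-((1 - s) * E))) (E * Real.exp (-((1 - s) * E))) s := by
    intro s _
    have h1 : HasDerivAt (fun s : ℝ => -((1 - s) * E)) E s := by
      have h := ((hasDerivAt_id s).mul_const E).sub_const E
      have hfun : (fun s : ℝ => -((1 - s) * E)) = fun s => id s * E - E := by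
        funext x
        simp only [id]
        ring
      rw [hfun]
      simpa using h
    have h2 := h1.exp
    simpa [mul_comm] using h2
  have hint : IntervalIntegrable (fun s : ℝ => E * Real.exp (-((1 - s) * E))) volume 0 1 :=
    (by fun_prop : Continuous fun s : ℝ => E * Real.exp (-((1 - s) * E))).intervalIntegrable 0 1
  rw [integral_eq_sub_of_hasDerivAt hder hint]
  simp

/-- **(II.29a)** p.337 [PDF 13] tl.11–15: «In every box of 𝐃 we write: `1 = τ(H_Δ) − ∫₀¹ ds H_Δ τ′((1 − s)H_Δ)`, where τ is our
reference C₀^∞ function» — true for every `C¹` function `τ : ℝ → ℝ` with `τ(0) = 1` (p.330: τ «is 1 for x < 1») and every real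
`H_Δ`. [cite: MagnenRivasseauSeneor1993, §II.B (II.29a) p.337] -/
theorem interp_tau_identity {τ : ℝ → ℝ} (hτ : ContDiff ℝ 1 τ) (hτ0 : τ 0 = 1) (H : ℝ) :
    τ H - ∫ s in (0 : ℝ)..1, H * deriv τ ((1 - s) * H) = 1 := by
  have hdiff : Differentiable ℝ τ := hτ.differentiable one_ne_zero
  have hcont : Continuous (deriv τ) := hτ.continuous_deriv_one
  have hder : ∀ s ∈ uIcc (0 : ℝ) 1,
      HasDerivAt (fun s : ℝ => τ ((1 - s) * H)) (-(H * deriv τ ((1 - s) * H))) s := by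
    intro s _
    have h1 : HasDerivAt (fun s : ℝ => (1 - s) * H) (-H) s := by
      have h := ((hasDerivAt_id s).const_sub (1 : ℝ)).mul_const H
      simpa using h
    have h2 : HasDerivAt (fun s : ℝ => τ ((1 - s) * H)) (deriv τ ((1 - s) * H) * -H) s :=
      (hdiff ((1 - s) * H)).hasDerivAt.comp s h1
    have h3 : deriv τ ((1 - s) * H) * -H = -(H * deriv τ ((1 - s) * H)) := by ring
    rw [h3] at h2
    exact h2
  have hint : IntervalIntegrable (fun s : ℝ => -(H * deriv τ ((1 - s) * H))) volume 0 1 := by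
    apply Continuous.intervalIntegrable
    exact (continuous_const.mul (hcont.comp (by fun_prop))).neg
  have hftc := integral_eq_sub_of_hasDerivAt hder hint
  rw [intervalIntegral.integral_neg] at hftc
  simp only [sub_self, zero_mul, sub_zero, one_mul, hτ0] at hftc
  linarith

/-! ## §2 The two-step bound behind (II.27) (p.336 tl.2–5) -/

/-- Weighted AM–GM in the form used on p.336: for `x, y > 0` and `r ∈ [0,1]`, `1/(x + y) ≤ x^{−r} y^{−(1−r)}`
(since `x^r y^{1−r} ≤ r x + (1 − r) y ≤ x + y`). [folklore] -/
private theorem one_div_add_le_rpow_neg {x y r : ℝ} (hx : 0 < x) (hy : 0 < y) (hr0 : 0 ≤ r) (hr1 : r ≤ 1) :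
    1 / (x + y) ≤ x ^ (-r) * y ^ (-(1 - r)) := by
  have hgm : x ^ r * y ^ (1 - r) ≤ r * x + (1 - r) * y :=
    Real.geom_mean_le_arith_mean2_weighted hr0 (by linarith) hx.le hy.le (by ring)
  have hle : x ^ r * y ^ (1 - r) ≤ x + y := by
    nlinarith [mul_nonneg hr0 hy.le, mul_nonneg (sub_nonneg.2 hr1) hx.le]
  have hpos : 0 < x ^ r * y ^ (1 - r) := by positivity
  rw [Real.rpow_neg hx.le, Real.rpow_neg hy.le, ← mul_inv, one_div]
  exact inv_anti₀ hpos hle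

/-- **p.336 [PDF 12] tl.2–5**, first step, verbatim: «This bound is immediate if we use integration by parts and the bound
`M^{3i}M^α/(M^{2α} + λ²M^{2i}) ≤ M^{3i}M^α M^{−2rα} λ^{−2(1−r)} M^{−2i(1−r)}`» — here for `M, λ > 0`, natural `i, α` and EVERY
`r ∈ [0,1]`, with the right side grouped as `M^{3i}M^α · (M^{2α})^{−r} · (λ²M^{2i})^{−(1−r)}`.
[cite: MagnenRivasseauSeneor1993, §II.B p.336 (bound after (II.27))] -/
theorem ineq_p336 {M lam r : ℝ} (hM : 0 < M) (hlam : 0 < lam) (hr0 : 0 ≤ r) (hr1 : r ≤ 1) (i α : ℕ) :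
    M ^ (3 * i) * M ^ α / (M ^ (2 * α) + lam ^ 2 * M ^ (2 * i)) ≤
      M ^ (3 * i) * M ^ α * ((M ^ (2 * α)) ^ (-r) * (lam ^ 2 * M ^ (2 * i)) ^ (-(1 - r))) := by
  have hx : 0 < M ^ (2 * α) := by positivity
  have hy : 0 < lam ^ 2 * M ^ (2 * i) := by positivity
  have hnum : 0 ≤ M ^ (3 * i) * M ^ α := by positivity
  rw [div_eq_mul_one_div]
  exact mul_le_mul_of_nonneg_left (one_div_add_le_rpow_neg hx hy hr0 hr1) hnum

/-- `(a²)^{−1/2} = a⁻¹` for `a > 0`. [folklore] -/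
private theorem sq_rpow_neg_half {a : ℝ} (ha : 0 < a) : (a ^ 2) ^ (-(1 / 2 : ℝ)) = a⁻¹ := by
  rw [← Real.rpow_two, ← Real.rpow_mul ha.le]
  norm_num
  exact Real.rpow_neg_one a

/-- **p.336 tl.5**, second step: «`≤ M^{2i}/λ if r = 1/2`» — at `r = 1/2` the middle term of `ineq_p336` EQUALS `M^{2i}/λ`.
[cite: MagnenRivasseauSeneor1993, §II.B p.336 (bound after (II.27))] -/
theorem ineq_p336_half {M lam : ℝ} (hM : 0 < M) (hlam : 0 < lam) (i α : ℕ) :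
    M ^ (3 * i) * M ^ α * ((M ^ (2 * α)) ^ (-(1 / 2 : ℝ)) * (lam ^ 2 * M ^ (2 * i)) ^ (-(1 - 1 / 2 : ℝ))) =
      M ^ (2 * i) / lam := by
  have h1 : (M ^ (2 * α) : ℝ) = (M ^ α) ^ 2 := by rw [← pow_mul, mul_comm]
  have h2 : lam ^ 2 * M ^ (2 * i) = (lam * M ^ i) ^ 2 := by rw [mul_pow, ← pow_mul, mul_comm 2 i]
  have h3 : (-(1 - 1 / 2 : ℝ)) = -(1 / 2 : ℝ) := by norm_num
  rw [h1, h2, h3, sq_rpow_neg_half (by positivity), sq_rpow_neg_half (by positivity)]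
  have hMi : M ^ i ≠ 0 := by positivity
  have hMa : M ^ α ≠ 0 := by positivity
  field_simp
  ring

/-- The printed chain at `r = 1/2`: `M^{3i}M^α/(M^{2α} + λ²M^{2i}) ≤ M^{2i}/λ` (the prefactor `K_q M^{2i}/λ` of (II.27)).
[cite: MagnenRivasseauSeneor1993, §II.B p.336 (bound after (II.27))] -/
theorem ineq_p336_chain {M lam : ℝ} (hM : 0 < M) (hlam : 0 < lam) (i α : ℕ) :
    M ^ (3 * i) * M ^ α / (M ^ (2 * α) + lam ^ 2 * M ^ (2 * i)) ≤ M ^ (2 * i) / lam := by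
  have h := ineq_p336 hM hlam (by norm_num : (0 : ℝ) ≤ 1 / 2) (by norm_num : (1 / 2 : ℝ) ≤ 1) i α
  rwa [ineq_p336_half hM hlam i α] at h

/-! ## §3 The local-factorial arithmetic (II.28) (p.336 tl.18–25) -/

/-- The common core of (II.28): with `P = 2n = λ^{−ε₁/2}`, for `c ≥ 0` with `c·λ^{3ε₁/2}/2 ≤ e^{−2}`,
`λ^{ε₁P} · cⁿ · n! ≤ e^{−λ^{−ε₁/2}}`. (Used with `c = K²` and with `c = K`.) [cite: MagnenRivasseauSeneor1993, §II.B (II.28) p.336] -/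
theorem localFactorial_core {lam ε₁ c : ℝ} {n : ℕ} (hlam : 0 < lam) (hc : 0 ≤ c)
    (hP : (2 * n : ℝ) = lam ^ (-(ε₁ / 2))) (hsmall : c * lam ^ (3 * ε₁ / 2) / 2 ≤ Real.exp (-2)) :
    lam ^ (ε₁ * (2 * n)) * c ^ n * (n ! : ℝ) ≤ Real.exp (-(lam ^ (-(ε₁ / 2)))) := by
  have hn : (n : ℝ) = lam ^ (-(ε₁ / 2)) / 2 := by linarith
  -- n! ≤ nⁿ
  have hfact : (n ! : ℝ) ≤ (n : ℝ) ^ n := by exact_mod_cast Nat.factorial_le_pow n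
  -- λ^{ε₁(2n)} = (λ^{2ε₁})ⁿ
  have h1 : lam ^ (ε₁ * (2 * n)) = (lam ^ (2 * ε₁)) ^ n := by
    rw [show ε₁ * (2 * (n : ℝ)) = (2 * ε₁) * n by ring, Real.rpow_mul_natCast hlam.le]
  -- λ^{2ε₁} · λ^{−ε₁/2} = λ^{3ε₁/2}
  have h3 : lam ^ (2 * ε₁) * lam ^ (-(ε₁ / 2)) = lam ^ (3 * ε₁ / 2) := by
    rw [← Real.rpow_add hlam]
    ring_nf
  have hstep : lam ^ (ε₁ * (2 * n)) * c ^ n * (n ! : ℝ) ≤ (lam ^ (2 * ε₁) * c * n) ^ n := by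
    rw [h1, mul_pow, mul_pow]
    have h0 : 0 ≤ (lam ^ (2 * ε₁)) ^ n * c ^ n := by positivity
    exact mul_le_mul_of_nonneg_left hfact h0
  have hbase : lam ^ (2 * ε₁) * c * n = c * lam ^ (3 * ε₁ / 2) / 2 := by
    rw [hn, ← h3]
    ring
  have hbase_nonneg : 0 ≤ lam ^ (2 * ε₁) * c * n := by positivity
  have hbase_le : lam ^ (2 * ε₁) * c * n ≤ Real.exp (-2) := by rw [hbase]; exact hsmall
  calc lam ^ (ε₁ * (2 * n)) * c ^ n * (n ! : ℝ)
      ≤ (lam ^ (2 * ε₁) * c * n) ^ n := hstep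
    _ ≤ (Real.exp (-2)) ^ n := pow_le_pow_left₀ hbase_nonneg hbase_le n
    _ = Real.exp (-(lam ^ (-(ε₁ / 2)))) := by
        rw [← Real.exp_nat_mul, ← hP]
        ring_nf

/-- **(II.28)** p.336 [PDF 12] tl.22–25, verbatim: «Therefore for each box Δ we have a factor
`(λ_i^t)^{ε₁P_i} K^{P_i} (P_i/2)! ≤ e^{−(λ_i^t)^{−ε₁/2}}` (II.28) if λ_i^t is small enough (such that `√K(λ_i^t)^{3ε₁/4} ≤ 1/e`,
recalling that `P_i = (λ_i^t)^{−ε₁/2}`).» Kernel-checked form: `P_i = 2n` an even natural number with `2n = λ^{−ε₁/2}` exactly,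
`K ≥ 0`, and the smallness condition `K·λ^{3ε₁/4} ≤ 1/e` (with `K`, not the printed `√K` — see
`printedCondition_counterexample` and `localFactorial_le_sqrt`). Proof: `n! ≤ nⁿ`, so the left side is at most
`(λ^{2ε₁}K²n)ⁿ = ((Kλ^{3ε₁/4})²/2)ⁿ ≤ e^{−2n} = e^{−P_i}`. [cite: MagnenRivasseauSeneor1993, §II.B (II.28) p.336] -/
theorem localFactorial_le {lam ε₁ K : ℝ} {n : ℕ} (hlam : 0 < lam) (hK : 0 ≤ K)
    (hP : (2 * n : ℝ) = lam ^ (-(ε₁ / 2))) (hsmall : K * lam ^ (3 * ε₁ / 4) ≤ Real.exp (-1)) :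
    lam ^ (ε₁ * (2 * n)) * K ^ (2 * n) * (n ! : ℝ) ≤ Real.exp (-(lam ^ (-(ε₁ / 2)))) := by
  rw [pow_mul]
  refine localFactorial_core hlam (sq_nonneg K) hP ?_
  have ha : 0 ≤ K * lam ^ (3 * ε₁ / 4) := by positivity
  have hsq : (K * lam ^ (3 * ε₁ / 4)) ^ 2 ≤ Real.exp (-1) ^ 2 := pow_le_pow_left₀ ha hsmall 2
  have he : Real.exp (-1) ^ 2 = Real.exp (-2) := by
    rw [← Real.exp_nat_mul]
    norm_num
  have h32 : K ^ 2 * lam ^ (3 * ε₁ / 2) = (K * lam ^ (3 * ε₁ / 4)) ^ 2 := by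
    rw [mul_pow, ← Real.rpow_mul_natCast hlam.le]
    ring_nf
  rw [h32]
  have hpos : 0 ≤ (K * lam ^ (3 * ε₁ / 4)) ^ 2 := sq_nonneg _
  linarith [Real.exp_pos (-2)]

/-- The alternative reading under which the PRINTED condition is exactly sufficient: with `K^{P_i/2}` in place of `K^{P_i}` (a
factor `√K` per field, i.e. one `K_q` of (II.27) per contracted pair), `√K λ^{3ε₁/4} ≤ 1/e` gives
`λ^{ε₁P} K^{P/2} (P/2)! ≤ e^{−λ^{−ε₁/2}}`. Recorded to show that the `√K`/`K` discrepancy of (II.28) is a bookkeeping convention, not a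
gap. [cite: MagnenRivasseauSeneor1993, §II.B (II.28) p.336] -/
theorem localFactorial_le_sqrt {lam ε₁ K : ℝ} {n : ℕ} (hlam : 0 < lam) (hK : 0 ≤ K)
    (hP : (2 * n : ℝ) = lam ^ (-(ε₁ / 2))) (hsmall : Real.sqrt K * lam ^ (3 * ε₁ / 4) ≤ Real.exp (-1)) :
    lam ^ (ε₁ * (2 * n)) * K ^ n * (n ! : ℝ) ≤ Real.exp (-(lam ^ (-(ε₁ / 2)))) := by
  refine localFactorial_core hlam hK hP ?_
  have ha : 0 ≤ Real.sqrt K * lam ^ (3 * ε₁ / 4) := by positivity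
  have hsq : (Real.sqrt K * lam ^ (3 * ε₁ / 4)) ^ 2 ≤ Real.exp (-1) ^ 2 := pow_le_pow_left₀ ha hsmall 2
  have he : Real.exp (-1) ^ 2 = Real.exp (-2) := by
    rw [← Real.exp_nat_mul]
    norm_num
  have h32 : K * lam ^ (3 * ε₁ / 2) = (Real.sqrt K * lam ^ (3 * ε₁ / 4)) ^ 2 := by
    rw [mul_pow, Real.sq_sqrt hK, ← Real.rpow_mul_natCast hlam.le]
    ring_nf
  rw [h32]
  have hpos : 0 ≤ (Real.sqrt K * lam ^ (3 * ε₁ / 4)) ^ 2 := sq_nonneg _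
  linarith [Real.exp_pos (-2)]

/-- `(1/16)^c = 2^{−4c}` (real exponents). [folklore] -/
private theorem sixteenth_rpow (c : ℝ) : (1 / 16 : ℝ) ^ c = (2 : ℝ) ^ (-4 * c) := by
  have h : (1 / 16 : ℝ) = (2 : ℝ) ^ (-4 : ℝ) := by
    rw [Real.rpow_neg (by norm_num : (0 : ℝ) ≤ 2), show (4 : ℝ) = ((4 : ℕ) : ℝ) by norm_num, Real.rpow_natCast]
    norm_num
  rw [h, ← Real.rpow_mul (by norm_num : (0 : ℝ) ≤ 2)]

/-- `((1/16)^m)^{c/m·…}`: for `m ≥ 1`, `((1/16)^m)^{x} = 2^{−4mx}`. [folklore] -/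
private theorem lam_rpow {m : ℕ} (x : ℝ) : ((1 / 16 : ℝ) ^ m) ^ x = (2 : ℝ) ^ (-4 * (m * x)) := by
  rw [← Real.rpow_natCast, ← Real.rpow_mul (by norm_num : (0 : ℝ) ≤ 1 / 16), sixteenth_rpow]

/-- **PRECISION on (II.28) (ours, kernel-checked; immaterial to Lemma II.1).** Read literally — factor `K^{P_i}`, sufficient
condition «`√K(λ_i^t)^{3ε₁/4} ≤ 1/e`» — the printed implication FAILS: for every `m ≥ 1` the data `λ = 16^{−m}`, `ε₁ = 1/m`
(so `λ^{ε₁} = 1/16`, and `λ`, `ε₁` are as small as one likes), `P_i = 4 = λ^{−ε₁/2}` (`n = 2`), `K = (8/e)² = 64/e²` satisfy the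
printed condition WITH EQUALITY, `√K λ^{3ε₁/4} = (8/e)(1/8) = 1/e`, while `λ^{ε₁P}K^P(P/2)! = 16^{−4}(64/e²)^4·2! = 512e^{−8} >
e^{−4} = e^{−λ^{−ε₁/2}}` (as `e⁴ < 512`). The condition with `K` in place of `√K` suffices (`localFactorial_le`); so does the printed
one under the reading `K^{P_i/2}` (`localFactorial_le_sqrt`). [cite: MagnenRivasseauSeneor1993, §II.B (II.28) p.336] -/
theorem printedCondition_counterexample {m : ℕ} (hm : 1 ≤ m) :
    (0 : ℝ) < (1 / 16) ^ m ∧ ((1 / 16 : ℝ) ^ m < 1) ∧ (0 : ℝ) < 1 / m ∧ (0 : ℝ) ≤ (8 / Real.exp 1) ^ 2 ∧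
      (2 * (2 : ℕ) : ℝ) = ((1 / 16 : ℝ) ^ m) ^ (-((1 / m : ℝ) / 2)) ∧
      Real.sqrt ((8 / Real.exp 1) ^ 2) * ((1 / 16 : ℝ) ^ m) ^ (3 * (1 / m : ℝ) / 4) = Real.exp (-1) ∧
      Real.exp (-(((1 / 16 : ℝ) ^ m) ^ (-((1 / m : ℝ) / 2)))) <
        ((1 / 16 : ℝ) ^ m) ^ ((1 / m : ℝ) * (2 * (2 : ℕ))) * ((8 / Real.exp 1) ^ 2) ^ (2 * 2) * ((2 : ℕ) ! : ℝ) := by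
  have hm0 : (m : ℝ) ≠ 0 := by exact_mod_cast (show m ≠ 0 by omega)
  have he0 : 0 < Real.exp 1 := Real.exp_pos 1
  -- the three powers of λ that occur
  have hA : ((1 / 16 : ℝ) ^ m) ^ (-((1 / m : ℝ) / 2)) = 4 := by
    rw [lam_rpow, show (-4 : ℝ) * (m * -(1 / (m : ℝ) / 2)) = ((2 : ℕ) : ℝ) by field_simp; ring, Real.rpow_natCast]
    norm_num
  have hB : ((1 / 16 : ℝ) ^ m) ^ (3 * (1 / m : ℝ) / 4) = 1 / 8 := by
    rw [lam_rpow, show (-4 : ℝ) * (m * (3 * (1 / (m : ℝ)) / 4)) = -((3 : ℕ) : ℝ) by field_simp; ring,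
      Real.rpow_neg (by norm_num : (0 : ℝ) ≤ 2), Real.rpow_natCast]
    norm_num
  have hC : ((1 / 16 : ℝ) ^ m) ^ ((1 / m : ℝ) * (2 * (2 : ℕ))) = 1 / 65536 := by
    rw [lam_rpow, show (-4 : ℝ) * (m * ((1 / (m : ℝ)) * (2 * ((2 : ℕ) : ℝ)))) = -((16 : ℕ) : ℝ) by
      push_cast; field_simp; ring,
      Real.rpow_neg (by norm_num : (0 : ℝ) ≤ 2), Real.rpow_natCast]
    norm_num
  refine ⟨by positivity, ?_, by positivity, by positivity, ?_, ?_, ?_⟩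
  · exact pow_lt_one₀ (by norm_num) (by norm_num) (by omega)
  · rw [hA]; norm_num
  · rw [hB, Real.sqrt_sq (by positivity), Real.exp_neg]
    field_simp
  · rw [hA, hC]
    have he : Real.exp 1 < 2.7182818286 := Real.exp_one_lt_d9
    have he4 : Real.exp 1 ^ 4 < 2.7182818286 ^ 4 := pow_lt_pow_left₀ he he0.le (by norm_num)
    have h512 : Real.exp 1 ^ 4 < 512 := lt_trans he4 (by norm_num)
    have hexp4 : Real.exp (-4) = (Real.exp 1 ^ 4)⁻¹ := by
      rw [Real.exp_neg, ← Real.exp_nat_mul]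
      norm_num
    have hexp8 : ((8 / Real.exp 1) ^ 2) ^ (2 * 2) = 8 ^ 8 / (Real.exp 1 ^ 4) ^ 2 := by
      rw [← pow_mul, div_pow]
      ring
    simp only [Nat.factorial_two, Nat.cast_ofNat]
    rw [hexp4, hexp8]
    have hp : 0 < Real.exp 1 ^ 4 := by positivity
    rw [inv_eq_one_div, div_lt_iff₀ hp]
    have : 1 / 65536 * (8 ^ 8 / (Real.exp 1 ^ 4) ^ 2) * 2 * Real.exp 1 ^ 4 = 512 / Real.exp 1 ^ 4 := by
      field_simp
      ring
    rw [this, lt_div_iff₀ hp]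
    linarith

/-! ## §4 The typed statements: (II.27) and Lemma II.1 -/

/-- **(II.27)** as a predicate, for ONE `q` and ONE constant `K_q`: the sliced axial-gauge propagator family `C i α` (slice index
`j = (i, α)`: `|p⃗| ∼ M^i`, `|p₀| ∼ M^α`; argument `z = x − y = (x₀ − y₀, x⃗ − y⃗) ∈ ℝ × ℝ³`) satisfies
«`C^j_axial(x − y) ≤ (K_q M^{2i}/λ) (1/(1 + |x₀ − y₀|M^α) · 1/(1 + |x⃗ − y⃗|M^i))^q`» (typed on absolute values, reading (v)).
[cite: MagnenRivasseauSeneor1993, §II.B (II.27) p.335] -/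
def AxialSliceBound (C : ℕ → ℕ → ℝ × EuclideanSpace ℝ (Fin 3) → ℝ) (M lam : ℝ) (q : ℕ) (Kq : ℝ) : Prop :=
  ∀ (i α : ℕ) (z : ℝ × EuclideanSpace ℝ (Fin 3)),
    |C i α z| ≤ Kq * M ^ (2 * i) / lam * (1 / (1 + |z.1| * M ^ α) * (1 / (1 + ‖z.2‖ * M ^ i))) ^ q

/-- **(II.27)** p.335 [PDF 11] tl.34–38, p.336 tl.2, verbatim: «we obtain pieces C^j_axial(p) ≡ κ^j(p)C_axial(p) which satisfy, for
any fixed large integer q, `C^j_axial(x − y) ≤ (K_q M^{2i}/λ)(1/(1 + |x₀ − y₀|M^α) · 1/(1 + |x⃗ − y⃗|M^i))^q`, (II.27) where K_q is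
some constant depending on q.» Quantifiers: `∀ q, ∃ K_q, ∀ (i, α), ∀ (x − y)` («large q» = all `q`, by `axialSliceBound_anti`).
A typed predicate on the kernel family — NOT proved here (it is an integration-by-parts estimate whose input, the axial covariance
(II.16)/(II.19) with the cutoffs (II.21), belongs to the statement layer). [cite: MagnenRivasseauSeneor1993, §II.B (II.27) pp.335–336] -/
def IneqII27Printed (C : ℕ → ℕ → ℝ × EuclideanSpace ℝ (Fin 3) → ℝ) (M lam : ℝ) : Prop :=
  ∀ q : ℕ, ∃ Kq : ℝ, AxialSliceBound C M lam q Kq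

/-- «for any fixed large integer q» loses nothing: for `M > 0`, `λ > 0`, `K_q ≥ 0` the decay factor lies in `(0, 1]`, so the
bound with exponent `q` implies the bound with every exponent `q′ ≤ q` and the same constant.
[cite: MagnenRivasseauSeneor1993, §II.B (II.27) p.335] -/
theorem axialSliceBound_anti {C : ℕ → ℕ → ℝ × EuclideanSpace ℝ (Fin 3) → ℝ} {M lam Kq : ℝ} {q q' : ℕ}
    (hM : 0 < M) (hlam : 0 < lam) (hKq : 0 ≤ Kq) (hq : q' ≤ q) (h : AxialSliceBound C M lam q Kq) :
    AxialSliceBound C M lam q' Kq := by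
  intro i α z
  refine (h i α z).trans ?_
  have hb0 : 0 ≤ 1 / (1 + |z.1| * M ^ α) * (1 / (1 + ‖z.2‖ * M ^ i)) := by positivity
  have hb1 : 1 / (1 + |z.1| * M ^ α) * (1 / (1 + ‖z.2‖ * M ^ i)) ≤ 1 := by
    have h1 : 1 / (1 + |z.1| * M ^ α) ≤ 1 := by
      rw [div_le_one (by positivity)]
      have : 0 ≤ |z.1| * M ^ α := by positivity
      linarith
    have h2 : 1 / (1 + ‖z.2‖ * M ^ i) ≤ 1 := by
      rw [div_le_one (by positivity)]
      have : 0 ≤ ‖z.2‖ * M ^ i := by positivity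
      linarith
    calc 1 / (1 + |z.1| * M ^ α) * (1 / (1 + ‖z.2‖ * M ^ i)) ≤ 1 * 1 :=
          mul_le_mul h1 h2 (by positivity) (by norm_num)
      _ = 1 := by norm_num
  have hpre : 0 ≤ Kq * M ^ (2 * i) / lam := by positivity
  exact mul_le_mul_of_nonneg_left (pow_le_pow_of_le_one hb0 hb1 hq) hpre

/-- Statement-level carrier for Lemma II.1 (reading (i) of the module docstring): the data the lemma speaks about, nothing of
the construction. `lamT i` = the tentative effective coupling `λ_i^t` of (II.12) at momentum index `i`; `Box i α` = the boxes of
the anisotropic lattice `𝐃_{i,α}` (p.335 tl.16–19: «𝐃_{i,α} is the lattice of boxes of side M^{−i} in the directions 1, 2, 3 and of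
side M^{−α} in the direction 0»); `KLFR i α` = those in the kernel of the large field region (p.335 tl.25–26: «The set of boxes in
which the error term is chosen in (II.25)»); `factor i α Δ` = the numerical factor the expansion associates to the box `Δ` in the
functional integral. [cite: MagnenRivasseauSeneor1993, §II.B (II.21)–(II.26) p.335] -/
structure LargeFieldData where
  /-- `λ_i^t`, the tentative effective coupling of (II.12) -/
  lamT : ℕ → ℝ
  /-- the boxes of `𝐃_{i,α}` -/
  Box : ℕ → ℕ → Type
  /-- the kernel of the large field region inside `𝐃_{i,α}` -/
  KLFR : (i α : ℕ) → Set (Box i α)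
  /-- the factor associated to a box in the functional integral -/
  factor : (i α : ℕ) → Box i α → ℝ

/-- **Lemma II.1** p.335 [PDF 11] tl.30–31, verbatim (page image `p11_lemmaII1_s2.png`): «To each box of KLFR ∩ 𝐃^{i,α} we can
associate a small factor in the functional integral which is `e^{−(λ_i^t)^{−ε}}`, for some ε = 0.» [sic — typed `0 < ε`: a «small
factor», and (II.28) exhibits the exponent `−(λ_i^t)^{−ε₁/2}`, i.e. `ε = ε₁/2 > 0`.] Quantifiers: ONE `ε > 0`, then every slice
pair `(i, α)` and every box of `KLFR ∩ 𝐃^{i,α}`. GRADE OF RECORD: SKETCH («Sketch of proof.» p.335 tl.32; p.336 tl.25–26, 34–37;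
p.354 tl.35 «the sketchy Lemma II.1»); completed, per the authors, by Sect. VI (Lemma VI.1). A typed predicate, never a `theorem`
here. [cite: MagnenRivasseauSeneor1993, §II.B Lemma II.1 p.335] -/
def LemmaII1Printed (D : LargeFieldData) : Prop :=
  ∃ ε : ℝ, 0 < ε ∧ ∀ (i α : ℕ) (Δ : D.Box i α), Δ ∈ D.KLFR i α →
    |D.factor i α Δ| ≤ Real.exp (-((D.lamT i) ^ (-ε)))

/-- Bookkeeping between (II.28) and Lemma II.1: if every KLFR box of slice `(i, α)` carries a factor bounded by the left side of
(II.28) with `P_i = 2n_i = (λ_i^t)^{−ε₁/2}` and the smallness condition of `localFactorial_le` holds at every `i`, then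
`LemmaII1Printed` holds with `ε = ε₁/2`. (Only the arithmetic; that the factor IS so bounded is the unformalised sketch.)
[cite: MagnenRivasseauSeneor1993, §II.B (II.28) and Lemma II.1 pp.335–336] -/
theorem lemmaII1_of_II28 (D : LargeFieldData) {ε₁ K : ℝ} (n : ℕ → ℕ) (hε₁ : 0 < ε₁) (hK : 0 ≤ K)
    (hlam : ∀ i, 0 < D.lamT i) (hP : ∀ i, (2 * n i : ℝ) = (D.lamT i) ^ (-(ε₁ / 2)))
    (hsmall : ∀ i, K * (D.lamT i) ^ (3 * ε₁ / 4) ≤ Real.exp (-1))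
    (hfactor : ∀ (i α : ℕ) (Δ : D.Box i α), Δ ∈ D.KLFR i α →
      |D.factor i α Δ| ≤ (D.lamT i) ^ (ε₁ * (2 * n i)) * K ^ (2 * n i) * ((n i) ! : ℝ)) :
    LemmaII1Printed D := by
  refine ⟨ε₁ / 2, by positivity, fun i α Δ hΔ => (hfactor i α Δ hΔ).trans ?_⟩
  exact localFactorial_le (hlam i) hK (hP i) (hsmall i)

end LargeField

end Literature.MathematicalPhysics.QuantumFieldTheory.MagnenRivasseauSeneor1993
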